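import Mathlib
import HarnessLib
import Summits.CriticalPhenomena.SAWScalingLimit.Theses.SAWDevelopingMap
import Literature.Probability.RandomPlanarGeometry.HexParafermion

/-!
# Sketch — crux HexTight (stmt-CriticalPhenomena-5423), crux-ideate round 1, ideator 2

First lemmas / atoms of the two idea cards `reversal-virgin-disc` and `direction-law-harnack`,
typed over existing declarations only (HexParafermion.lean: `HexMidEdgeSAW`, `hexDomainBoundary`,
`hexDomainSimplyConnected`, `hexMidpoint`, `hexParafermionicObservable`, `hexCriticalFugacity`;
route file SAWDevelopingMap: `NoFoldBound`, `InteriorFlattening`, `HexTight`).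
Nothing here is proved; everything must elaborate.
-/

open scoped BigOperators Classical
open Literature.Probability.LatticeModels Literature.Probability.RandomPlanarGeometry
  Literature.Probability.RandomPlanarGeometry.SAW

namespace Summit.CriticalPhenomena.SAWScalingLimit.Cruxes.HexTight.Sketch

noncomputable section

/-- The `x_c`-mass of self-avoiding arcs of the vertex domain `Λ` between the mid-edges
`w` and `w'` (the unnormalised two-point function `Z_Λ(w → w')`). -/
def arcMass (Λ : Finset HexVertex) (w w' : Sym2 HexVertex) : ℝ :=
  ∑ γ : HexMidEdgeSAW Λ w w', hexCriticalFugacity ^ γ.length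

/-- The `x_c`-mass of the arcs `w → w'` in `Λ` that **dive to radius `ρ` about `z₀`**: some
visited vertex lies in the closed disc `B̄(z₀, ρ)` (lattice units of `hexCenter`). -/
def diveMass (Λ : Finset HexVertex) (w w' : Sym2 HexVertex) (z₀ : ℂ) (ρ : ℝ) : ℝ :=
  ∑ γ : HexMidEdgeSAW Λ w w',
    if ∃ v ∈ γ.verts, dist (hexCenter v) z₀ ≤ ρ then hexCriticalFugacity ^ γ.length else 0

/-! ## Card 1 `reversal-virgin-disc` -/

/-- **First lemma of card 1 (REVERSAL RECURSION, provable now).** Arcs from `w` to `w'`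
(boundary mid-edges of the simply connected `Λ`, both at distance `≥ r₁ + 1` from `z₀`, with the
open lattice disc of radius `r₁` inside `Λ`): if every sub-configuration "simply connected
`Λ' ⊆ Λ` still containing the open disc of radius `r₁`, two boundary mid-edges `u, u'` within
`1` of the circle of radius `r₁`" has dive ratio (to radius `r₂ ≤ r₁ - 1`) at most `q`, then the
mass of arcs diving to `r₂` is at most `q` times the mass of arcs diving to `r₁`.
Proof sketch: cut `γ` at its first entrance into `B̄(z₀,r₁)` (prefix `β`, cut mid-edge `m`),
reverse the remainder and cut it at ITS first entrance (prefix `β'`, cut mid-edge `m'`); the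
connector is an arc `m' → m` of `Λ ∖ β ∖ β'`, the map is a weight-preserving bijection, `γ` dives
to `r₂` iff the connector does, and `(Λ ∖ β ∖ β', m', m)` is again in the class. -/
def DiveRecursion : Prop :=
  ∀ (q : ℝ) (z₀ : ℂ) (r₁ r₂ : ℝ) (Λ : Finset HexVertex) (w w' : Sym2 HexVertex),
    0 ≤ q → r₂ + 1 ≤ r₁ →
    (∀ v : HexVertex, dist (hexCenter v) z₀ < r₁ → v ∈ Λ) →
    hexDomainSimplyConnected Λ → w ∈ hexDomainBoundary Λ → w' ∈ hexDomainBoundary Λ →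
    r₁ + 1 ≤ dist (hexMidpoint w) z₀ → r₁ + 1 ≤ dist (hexMidpoint w') z₀ →
    (∀ (Λ' : Finset HexVertex) (u u' : Sym2 HexVertex), Λ' ⊆ Λ →
        (∀ v : HexVertex, dist (hexCenter v) z₀ < r₁ → v ∈ Λ') →
        hexDomainSimplyConnected Λ' → u ∈ hexDomainBoundary Λ' → u' ∈ hexDomainBoundary Λ' →
        r₁ - 1 ≤ dist (hexMidpoint u) z₀ → dist (hexMidpoint u) z₀ ≤ r₁ + 1 →
        r₁ - 1 ≤ dist (hexMidpoint u') z₀ → dist (hexMidpoint u') z₀ ≤ r₁ + 1 →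
        diveMass Λ' u u' z₀ r₂ ≤ q * arcMass Λ' u u') →
    diveMass Λ w w' z₀ r₂ ≤ q * diveMass Λ w w' z₀ r₁

/-- **Atom 1 of card 1 (ONE-SCALE DIVE BOUND in a virgin disc, `q* < 1`).** For every simply
connected `Λ` containing the open lattice disc `B(z₀, N)` and boundary mid-edges `w, w'` within `1`
of the circle of radius `N` (in applications: tips of two slits coming from outside), the arcs
`w → w'` that dive to radius `N/2` carry at most the fraction `q < 1` of the total arc mass,
uniformly in `N ≥ N₀`, `z₀`, `Λ`, `w`, `w'`. -/
def OneScaleDive : Prop :=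
  ∃ q : ℝ, q < 1 ∧ ∃ N₀ : ℝ, ∀ (N : ℝ) (z₀ : ℂ) (Λ : Finset HexVertex) (w w' : Sym2 HexVertex),
    N₀ ≤ N →
    (∀ v : HexVertex, dist (hexCenter v) z₀ < N → v ∈ Λ) →
    hexDomainSimplyConnected Λ → w ∈ hexDomainBoundary Λ → w' ∈ hexDomainBoundary Λ →
    N - 1 ≤ dist (hexMidpoint w) z₀ → dist (hexMidpoint w) z₀ ≤ N + 1 →
    N - 1 ≤ dist (hexMidpoint w') z₀ → dist (hexMidpoint w') z₀ ≤ N + 1 →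
    diveMass Λ w w' z₀ (N / 2) ≤ q * arcMass Λ w w'

/-- **Bulk one-arm decay (the output of DiveRecursion + OneScaleDive).** In the class of atom 1
(at scale `2^m N`), the arcs diving through `m` dyadic shells, to radius `N`, carry at most
`q^m` of the arc mass. -/
def BulkOneArmDecay : Prop :=
  ∃ q : ℝ, q < 1 ∧ ∃ N₀ : ℝ, ∀ (m : ℕ) (N : ℝ) (z₀ : ℂ) (Λ : Finset HexVertex)
    (w w' : Sym2 HexVertex),
    N₀ ≤ N →
    (∀ v : HexVertex, dist (hexCenter v) z₀ < 2 ^ m * N → v ∈ Λ) →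
    hexDomainSimplyConnected Λ → w ∈ hexDomainBoundary Λ → w' ∈ hexDomainBoundary Λ →
    2 ^ m * N - 1 ≤ dist (hexMidpoint w) z₀ → dist (hexMidpoint w) z₀ ≤ 2 ^ m * N + 1 →
    2 ^ m * N - 1 ≤ dist (hexMidpoint w') z₀ → dist (hexMidpoint w') z₀ ≤ 2 ^ m * N + 1 →
    diveMass Λ w w' z₀ N ≤ q ^ m * arcMass Λ w w'

/-! ## Card 2 `direction-law-harnack` -/

/-- **First lemma of card 2 (BOUNDARY MODULUS IS MASS, provable now).** At a boundary mid-edge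
`z` of a simply connected domain with boundary source `a`, all arcs `a → z` have the same winding
(DCS, proof of Lemma 2), so the modulus of the parafermionic observable equals the arc mass:
`‖F(z)‖ = Z_Λ(a → z)`. Consequently the developing map `H` (`F = dH`, PotentialExists) sends a
boundary arc `J` to a polyline of length `Σ_{z ∈ J} Z_Λ(a → z)` ("length is mass"). -/
def BoundaryModulusIsMass : Prop :=
  ∀ (Λ : Finset HexVertex), hexDomainSimplyConnected Λ →
    ∀ a ∈ hexDomainBoundary Λ, ∀ z ∈ hexDomainBoundary Λ,
      ‖hexParafermionicObservable Λ a hexCriticalFugacity (5 / 8) z‖ = arcMass Λ a z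

/-- The sub-domain used in atom `AnnulusCutHarnack`: remove from `Λ` the closed lattice disc
`B̄(z₀, N/2)` and a horizontal half-strip of width `2` from it to the right (the cut), so that the
result is again simply connected. -/
def annulusCut (Λ : Finset HexVertex) (z₀ : ℂ) (N : ℝ) : Finset HexVertex :=
  Λ.filter fun v => N / 2 < dist (hexCenter v) z₀ ∧
    ¬ (0 ≤ (hexCenter v - z₀).re ∧ |(hexCenter v - z₀).im| ≤ 1)

/-- **Atom of card 2 (POINTWISE BOUNDARY HARNACK for the annulus cut).** Removing the central
disc of half the radius together with a cut to the outside costs at most a constant factor of the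
arc mass between two boundary mid-edges on the far (left) part of the circle, uniformly: the
nested-domain ratio `Z_{Λ''}(w → w') / Z_Λ(w → w') ≥ c`. Three rotated copies give
`OneScaleDive` with `q = 1 - c`. Card 2's mechanism: `NoFoldBound ∧ InteriorFlattening` force it
(same boundary-direction law for `H_Λ` and `H_{Λ''}` ⇒ qc reflection ⇒ boundary stretch ratio
bounded, δ-uniformly). -/
def AnnulusCutHarnack : Prop :=
  ∃ c : ℝ, 0 < c ∧ ∃ N₀ : ℝ, ∀ (N : ℝ) (z₀ : ℂ) (Λ : Finset HexVertex) (w w' : Sym2 HexVertex),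
    N₀ ≤ N →
    (∀ v : HexVertex, dist (hexCenter v) z₀ < N → v ∈ Λ) →
    hexDomainSimplyConnected Λ → w ∈ hexDomainBoundary Λ → w' ∈ hexDomainBoundary Λ →
    N - 1 ≤ dist (hexMidpoint w) z₀ → dist (hexMidpoint w) z₀ ≤ N + 1 →
    N - 1 ≤ dist (hexMidpoint w') z₀ → dist (hexMidpoint w') z₀ ≤ N + 1 →
    (hexMidpoint w - z₀).re ≤ -(N / 4) → (hexMidpoint w' - z₀).re ≤ -(N / 4) →
    c * arcMass Λ w w' ≤ arcMass (annulusCut Λ z₀ N) w w'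

/-- **Card 2's milestone implication inside route SAWDevelopingMap**: the no-fold bound (K) and
interior flattening (M) imply the pointwise boundary Harnack atom. -/
def CardTwoMilestone : Prop :=
  Summit.CriticalPhenomena.SAWScalingLimit.Theses.SAWDevelopingMap.NoFoldBound →
    Summit.CriticalPhenomena.SAWScalingLimit.Theses.SAWDevelopingMap.InteriorFlattening →
      AnnulusCutHarnack

/-- The shape of the whole line (both cards together; `VisitCharge` = atom 2 of card 1, informal
in the card, enters as a hypothesis `Prop` here). -/
def LineShape (VisitCharge : Prop) : Prop :=
  DiveRecursion → OneScaleDive → VisitCharge →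
    Summit.CriticalPhenomena.SAWScalingLimit.Theses.SAWDevelopingMap.HexTight

end

end Summit.CriticalPhenomena.SAWScalingLimit.Cruxes.HexTight.Sketch
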